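import Mathlib.RingTheory.Derivation.Basic
import Mathlib.RingTheory.DedekindDomain.Ideal.Lemmas
import HarnessLib

/-!
# A derivation transversal to a prime of a Dedekind `ℚ`-algebra lowers the `𝔭`-adic order by exactly one

R. C. Mason, *Diophantine Equations over Function Fields*, LMS Lecture Notes 96 (1984), Ch. I §2,
inequality (6): for the local derivation `d/dv` at a place `v` of a function field in characteristic
zero, `v(df/dv) ≥ v(f) − 1`, and `v(df/dv) ≥ 0` if `v(f) ≥ 0` — "readily obtained by considering the
Laurent expansion of `f` in powers of `z_v`"; the same expansion gives EQUALITY `v(df/dv) = v(f) − 1`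
when `v(f) ≠ 0` (characteristic zero). [cite: Mason1984, Ch. I §2 (6)] We prove the ideal-theoretic
form of both statements for an arbitrary derivation of a Dedekind domain that is transversal to the
prime in question (so that it agrees with `d/dv` up to a unit), which is the form needed for orders of
regular functions and of their derivatives on a smooth affine curve (standard; cf. also the
computation of the different via `f′(θ)`, Neukirch, *Algebraic Number Theory*, III (2.4)).

Let `R` be a commutative ring and `D : R → R` a derivation.

* `derivation_apply_mem_pow` — Leibniz: `D(I^(n+1)) ⊆ I^n` for every ideal `I`.
* `derivation_apply_not_mem_pow` — if `R` is a Dedekind domain and a `ℚ`-algebra, `P ≠ 0` a prime,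
  and `D` is TRANSVERSAL to `P` (some `π ∈ P` has `D π ∉ P`; such a `π` is automatically a
  uniformizer, `π ∉ P²`), then for `f ∈ P^(n+1) ∖ P^(n+2)` one has `D f ∉ P^(n+1)`; together with the
  first lemma, `ord_P (D f) = ord_P f − 1` whenever `ord_P f ≥ 1`.

Typical use (abc-iut cell, route item GenEllTwo, [GenEll] Thm 2.1 via the curve
`D_e : s² = 1 − 4r^e`): for the regular derivation `D = r²s³·d/dr` of `ℚ[r,s]/(s²−1+4r^e)` and a point
`Q` with `r(Q)s(Q) ≠ 0`, `D(r − r(Q)) = r²s³ ∉ 𝔭_Q`, so `ord_Q D(t − b) = ord_Q (t − b) − 1`, i.e.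
`ord_Q N = e_Q − 1` for `N = D t` — the divisor identity `div(N) = R_t − (3e+3)·Q_∞`.
No new definitions.
-/

namespace Literature.Algebra.Derivations

open Ideal

variable {R : Type*} [CommRing R]

/-- **Leibniz rule on ideal powers** — the ideal form of Mason's `v(df/dv) ≥ v(f) − 1`: a derivation
maps `I^(n+1)` into `I^n`, for every ideal `I` of a commutative ring. [cite: Mason1984, Ch. I §2 (6)] -/
theorem derivation_apply_mem_pow (D : Derivation ℤ R R) (I : Ideal R) :
    ∀ (n : ℕ) {f : R}, f ∈ I ^ (n + 1) → D f ∈ I ^ n := by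
  intro n
  induction n with
  | zero => intro f _; simp
  | succ n ih =>
    intro f hf
    rw [pow_succ'] at hf
    refine Submodule.mul_induction_on hf (fun a ha b hb => ?_) (fun x y hx hy => ?_)
    · rw [Derivation.leibniz, smul_eq_mul, smul_eq_mul, pow_succ']
      exact Ideal.add_mem _ (Ideal.mul_mem_mul ha (ih hb))
        (by rw [← pow_succ']; exact Ideal.mul_mem_right _ _ hb)
    · rw [map_add]
      exact Ideal.add_mem _ hx hy

/-- If some `π ∈ P` has `D π ∉ P`, then `π ∉ P²` (since `D(P²) ⊆ P`): an element on which a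
derivation is transversal to `P` is a uniformizer at `P`. [cite: Mason1984, Ch. I §2 (6)] -/
theorem not_mem_sq_of_derivation_not_mem (D : Derivation ℤ R R) {P : Ideal R} {π : R}
    (hDπ : D π ∉ P) : π ∉ P ^ 2 := fun h =>
  hDπ (by simpa using derivation_apply_mem_pow D P 1 h)

section Dedekind

variable [IsDedekindDomain R]

/-- In a Dedekind domain: `x ∈ P^k ↔ k ≤ emultiplicity P (span {x})` — membership in a prime power
is the `P`-adic order ("`v(f) ≥ k`"; prime factorisation of ideals, Neukirch I (3.3)).
[cite: NeukirchANT1999, Ch. I (3.3)] -/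
theorem mem_pow_iff_le_emultiplicity {P : Ideal R} (k : ℕ) (x : R) :
    x ∈ P ^ k ↔ (k : ℕ∞) ≤ emultiplicity P (Ideal.span {x}) := by
  rw [← pow_dvd_iff_le_emultiplicity, Ideal.dvd_span_singleton]

/-- `emultiplicity P (span {π ^ m}) = m` for `π ∈ P ∖ P²`, `P` a nonzero prime of a Dedekind
domain ("`v(z_v^m) = m`" for a local parameter). [cite: NeukirchANT1999, Ch. I (3.3)] -/
theorem emultiplicity_span_pow_eq {P : Ideal R} [hPp : P.IsPrime] (hP : P ≠ ⊥) {π : R}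
    (hπ : π ∈ P) (hπ2 : π ∉ P ^ 2) (m : ℕ) :
    emultiplicity P (Ideal.span {π ^ m}) = m := by
  have hprime : Prime P := Ideal.prime_of_isPrime hP hPp
  have h1 : emultiplicity P (Ideal.span {π}) = 1 := by
    rw [show (1 : ℕ∞) = ((1 : ℕ) : ℕ∞) by norm_num, emultiplicity_eq_coe]
    refine ⟨?_, ?_⟩
    · rw [pow_one, Ideal.dvd_span_singleton]; exact hπ
    · rw [Ideal.dvd_span_singleton]; exact hπ2
  rw [← Ideal.span_singleton_pow, emultiplicity_pow hprime, h1, mul_one]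

/-- **A transversal derivation lowers the `P`-adic order by exactly one** (characteristic zero).
`R` a Dedekind domain and a `ℚ`-algebra, `D : R → R` a derivation, `P ≠ 0` prime, `π ∈ P` with
`D π ∉ P`. If `f ∈ P^(n+1)` and `f ∉ P^(n+2)`, then `D f ∉ P^(n+1)` (and `D f ∈ P^n` by
`derivation_apply_mem_pow`). Proof: `P^(n+1) = (π^(n+1)) + P^(n+2)`, so `f = a·π^(n+1) + g` with
`a ∉ P`, `g ∈ P^(n+2)`; then `D f ≡ (n+1)·a·D π·π^n (mod P^(n+1))`, and `(n+1)·a·D π ∉ P` while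
`π^n ∉ P^(n+1)` — the Laurent-expansion argument behind Mason's (6), giving EQUALITY in
characteristic zero. [cite: Mason1984, Ch. I §2 (6)] -/
theorem derivation_apply_not_mem_pow [Algebra ℚ R] (D : Derivation ℤ R R) {P : Ideal R}
    [hPp : P.IsPrime] (hP : P ≠ ⊥) {π : R} (hπ : π ∈ P) (hDπ : D π ∉ P) {n : ℕ} {f : R}
    (hf : f ∈ P ^ (n + 1)) (hf' : f ∉ P ^ (n + 2)) : D f ∉ P ^ (n + 1) := by
  classical
  have hprime : Prime P := Ideal.prime_of_isPrime hP hPp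
  have hπ2 : π ∉ P ^ 2 := not_mem_sq_of_derivation_not_mem D hDπ
  have hπ0 : π ≠ 0 := by rintro rfl; exact hπ2 (Ideal.zero_mem _)
  -- Step 1: `P^(n+2) ⊔ (π^(n+1)) = P^(n+1)`.
  have hspan0 : Ideal.span {π ^ (n + 1)} ≠ ⊥ := by
    rw [Ne, Ideal.span_singleton_eq_bot]; exact pow_ne_zero _ hπ0
  have hem : emultiplicity P (Ideal.span {π ^ (n + 1)}) = (n + 1 : ℕ) :=
    emultiplicity_span_pow_eq hP hπ hπ2 (n + 1)
  have hmult : multiplicity P (Ideal.span {π ^ (n + 1)}) = n + 1 :=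
    multiplicity_eq_of_emultiplicity_eq_some hem
  have hsup : P ^ (n + 2) ⊔ Ideal.span {π ^ (n + 1)} = P ^ (n + 1) := by
    rw [Ideal.irreducible_pow_sup_of_ge hspan0 hprime.irreducible (n + 2)
      (by rw [hem]; exact_mod_cast Nat.le_succ _), hmult]
  -- Step 2: decompose `f = g + a·π^(n+1)`, `g ∈ P^(n+2)`, and show `a ∉ P`.
  have hf2 : f ∈ P ^ (n + 2) ⊔ Ideal.span {π ^ (n + 1)} := by rw [hsup]; exact hf
  obtain ⟨g, hg, h, hh, hgh⟩ := Submodule.mem_sup.mp hf2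
  obtain ⟨a, rfl⟩ := Ideal.mem_span_singleton'.mp hh
  have ha : a ∉ P := by
    intro haP
    apply hf'
    rw [← hgh]
    refine Ideal.add_mem _ hg ?_
    rw [pow_succ']
    exact Ideal.mul_mem_mul haP (Ideal.pow_mem_pow hπ _)
  -- Step 3: `D f ≡ (n+1)·a·Dπ·π^n (mod P^(n+1))`.
  intro hDf
  have hDg : D g ∈ P ^ (n + 1) := derivation_apply_mem_pow D P (n + 1) hg
  have hkey : ((n + 1 : ℕ) : R) * a * D π * π ^ n ∈ P ^ (n + 1) := by
    have hD : D (g + a * π ^ (n + 1)) = D g + (a * ((n + 1) • (π ^ n * D π)) + π ^ (n + 1) * D a) := by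
      rw [map_add, Derivation.leibniz, Derivation.leibniz_pow, smul_eq_mul, smul_eq_mul, smul_eq_mul,
        Nat.add_sub_cancel]
    rw [hgh] at hD
    have h3 : π ^ (n + 1) * D a ∈ P ^ (n + 1) := Ideal.mul_mem_right _ _ (Ideal.pow_mem_pow hπ _)
    have h4 : a * ((n + 1) • (π ^ n * D π)) ∈ P ^ (n + 1) := by
      have := Ideal.sub_mem _ (Ideal.sub_mem _ (hD ▸ hDf) hDg) h3
      simpa using this
    have h5 : a * ((n + 1) • (π ^ n * D π)) = ((n + 1 : ℕ) : R) * a * D π * π ^ n := by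
      rw [nsmul_eq_mul]; push_cast; ring
    rwa [h5] at h4
  -- Step 4: `(n+1)·a·Dπ ∉ P` and `π^n ∉ P^(n+1)` — contradiction with `Ideal.IsPrime.mul_mem_pow`.
  have hunit : IsUnit (((n + 1 : ℕ) : R)) := by
    have : ((n + 1 : ℕ) : R) = algebraMap ℚ R ((n + 1 : ℕ) : ℚ) := by simp
    rw [this]
    exact (IsUnit.mk0 _ (by exact_mod_cast Nat.succ_ne_zero n)).map _
  have hc : ((n + 1 : ℕ) : R) * a * D π ∉ P := by
    intro hc
    rcases hPp.mem_or_mem hc with hc' | hc'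
    · rcases hPp.mem_or_mem hc' with hc'' | hc''
      · exact hPp.ne_top (Ideal.eq_top_of_isUnit_mem _ hc'' hunit)
      · exact ha hc''
    · exact hDπ hc'
  rcases Ideal.IsPrime.mul_mem_pow P hkey with h1 | h1
  · exact hc h1
  · rw [mem_pow_iff_le_emultiplicity, emultiplicity_span_pow_eq hP hπ hπ2 n] at h1
    exact absurd (by exact_mod_cast h1 : n + 1 ≤ n) (Nat.not_succ_le_self n)

/-- **`ord_P (D f) = ord_P f − 1`** in the two-sided membership form: for `f ∈ P^(n+1) ∖ P^(n+2)`,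
`D f ∈ P^n ∖ P^(n+1)` (Mason's (6) with equality, characteristic zero, transversal derivation).
[cite: Mason1984, Ch. I §2 (6)] -/
theorem derivation_apply_mem_pow_and_not_mem [Algebra ℚ R] (D : Derivation ℤ R R) {P : Ideal R}
    [P.IsPrime] (hP : P ≠ ⊥) {π : R} (hπ : π ∈ P) (hDπ : D π ∉ P) {n : ℕ} {f : R}
    (hf : f ∈ P ^ (n + 1)) (hf' : f ∉ P ^ (n + 2)) : D f ∈ P ^ n ∧ D f ∉ P ^ (n + 1) :=
  ⟨derivation_apply_mem_pow D P n hf, derivation_apply_not_mem_pow D hP hπ hDπ hf hf'⟩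

/-- The same in terms of `emultiplicity` on ideals: if `emultiplicity P (f) = n + 1` then
`emultiplicity P (D f) = n` ("`v(df/dv) = v(f) − 1` for `v(f) ≥ 1`"). [cite: Mason1984, Ch. I §2 (6)] -/
theorem emultiplicity_span_derivation [Algebra ℚ R] (D : Derivation ℤ R R) {P : Ideal R}
    [P.IsPrime] (hP : P ≠ ⊥) {π : R} (hπ : π ∈ P) (hDπ : D π ∉ P) {n : ℕ} {f : R}
    (hf : emultiplicity P (Ideal.span {f}) = (n + 1 : ℕ)) :
    emultiplicity P (Ideal.span {D f}) = n := by
  have h1 : f ∈ P ^ (n + 1) := by rw [mem_pow_iff_le_emultiplicity, hf]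
  have h2 : f ∉ P ^ (n + 2) := by
    rw [mem_pow_iff_le_emultiplicity, hf]
    exact_mod_cast Nat.not_succ_le_self (n + 1)
  obtain ⟨h3, h4⟩ := derivation_apply_mem_pow_and_not_mem D hP hπ hDπ h1 h2
  rw [mem_pow_iff_le_emultiplicity] at h3 h4
  exact le_antisymm (not_lt.mp fun h => h4 (Order.add_one_le_of_lt (by exact_mod_cast h))) h3

end Dedekind

end Literature.Algebra.Derivations
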